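import Mathlib
import Summits.Ventures.PercRepro2.Defs
import Summits.Ventures.PercRepro2.Graph
import Summits.Ventures.PercRepro2.Harris
import Summits.Ventures.PercRepro2.Induced
import Summits.Ventures.PercRepro2.Events
import Summits.Ventures.PercRepro2.CCTRootEdge
import Summits.Ventures.PercRepro2.RowC1Cross
import Summits.Ventures.PercRepro2.RowC1CrossRoot

/-!
# The closed half of the cross term at an `a₂`-edge is a theorem modulo the row on `p[e↦1]`
(blind cell PercRepro2, p2 g33; proofs/P2-G33-CROSS.md §3, §8)

Mirror of `RowC1CrossRoot.lean`.  At an edge `e = {a₂, v}` at the root `a₂` of `H`, opening `e`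
RAISES `P(b ∈ H ∣ Q)`: `P⁰(Q bH) · P¹(Q) ≤ P¹(Q bH) · P⁰(Q)` (`bHQ_pin_open_mul_ge`) — this is the
cell's shift lemma at a root edge, `CCT.shift_root_edge` (typer-1 / mine-c), with the root `a₂`, the
avoided set `{a₁}` and the up-set `{B ∣ b ∈ B}`.  (Likewise `bHQ_pin_open_mul_le` of
`RowC1CrossRoot.lean`, the `a₁`-edge comparison, is the special case `s = a₂`, `T = {a₁}`,
`A = {b}` of `CCT.shift_avoided_edge`.)  Hence the CLOSED half
`c1CrossClosedHalf = P⁰(Q) P¹(Q oU bU) − P⁰(Q bH) P¹(Q oU)` at an `a₂`-edge satisfies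

  `c1CrossClosedHalf · P¹(Q) = P⁰(Q) · c1Slack p[e↦1] + P¹(Q oU) · (P¹(Q bH) P⁰(Q) − P⁰(Q bH) P¹(Q))`

(`crossClosedHalf_mul_eq`), both summands `≥ 0` once the row holds for `p[e↦1]`
(`crossClosedHalf_nonneg_of_row`).  Kit j333904 (n 6–8): the closed half is `≥ 0` on all
213,200 `a₂`-edges while the open half fails on 42,724 of them; at `a₁`-edges it is the other way
round (`RowC1CrossRoot.lean`).  Std axioms.
-/

namespace Summit.Ventures.PercRepro2

namespace RowC1

section CrossRootB

variable {V : Type*} {E : Type*} [Fintype E] [DecidableEq E] [Fintype V] [DecidableEq V]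
  {R : Type*} [Field R] [LinearOrder R] [IsStrictOrderedRing R]

omit [Fintype E] [DecidableEq E] [Fintype V] [DecidableEq V] [Field R] [LinearOrder R]
  [IsStrictOrderedRing R] in
/-- `{a₂ ↮ a₁} ∩ {b ∈ C(a₂)} = {b ∈ H} ∩ Q` in the row's spelling. -/
lemma avoid_inter_clusterIn_eq (ends : E → Sym2 V) (a₁ a₂ b : V) :
    avoidAll ends a₂ {a₁} ∩ clusterInEvent ends a₂ {B : Set V | b ∈ B} =
      connEvent ends a₂ b ∩ (connEvent ends a₁ a₂)ᶜ := by
  ext ω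
  simp only [Set.mem_inter_iff, avoidAll, Set.mem_setOf_eq, Finset.mem_singleton, forall_eq,
    mem_clusterInEvent, mem_cluster, Set.mem_compl_iff, mem_connEvent]
  exact ⟨fun ⟨h₁, hb⟩ => ⟨hb, fun h => h₁ (conn_symm h)⟩,
    fun ⟨hb, h₁⟩ => ⟨fun h => h₁ (conn_symm h), hb⟩⟩

omit [Fintype E] [DecidableEq E] [Fintype V] [DecidableEq V] [Field R] [LinearOrder R]
  [IsStrictOrderedRing R] in
/-- `{a₂ ↮ a₁} = Q`. -/
lemma avoid_singleton_eq_Q (ends : E → Sym2 V) (a₁ a₂ : V) :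
    avoidAll ends a₂ {a₁} = (connEvent ends a₁ a₂)ᶜ := by
  ext ω
  simp only [avoidAll, Set.mem_setOf_eq, Finset.mem_singleton, forall_eq, Set.mem_compl_iff,
    mem_connEvent]
  exact ⟨fun h h' => h (conn_symm h'), fun h h' => h (conn_symm h')⟩

/-- **The `a₂`-edge comparison**: for `e = {a₂, v}`, `P⁰(Q, b ∈ H) · P¹(Q) ≤ P¹(Q, b ∈ H) · P⁰(Q)`
— opening an edge at the root of `H` raises `P(b ∈ H ∣ Q)` (`CCT.shift_root_edge` with the root
`a₂`, the avoided set `{a₁}` and the up-set `{B ∣ b ∈ B}`). -/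
theorem bHQ_pin_open_mul_ge (p : E → R) (hp : IsProbVec p) (ends : E → Sym2 V) {e : E}
    {a₂ v : V} (hends : ends e = s(a₂, v)) (a₁ b : V) :
    prob (Function.update p e (0 : R)) (connEvent ends a₂ b ∩ (connEvent ends a₁ a₂)ᶜ) *
        prob (Function.update p e (1 : R)) (connEvent ends a₁ a₂)ᶜ ≤
      prob (Function.update p e (1 : R)) (connEvent ends a₂ b ∩ (connEvent ends a₁ a₂)ᶜ) *
        prob (Function.update p e (0 : R)) (connEvent ends a₁ a₂)ᶜ := by
  have hU : IsUpperSet {B : Set V | b ∈ B} := fun _ _ hST h => hST h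
  have h := CCT.shift_root_edge p ends hp hends ({a₁} : Finset V) hU
  rw [avoid_inter_clusterIn_eq, avoid_singleton_eq_Q] at h
  exact h

omit [Fintype V] [DecidableEq V] [LinearOrder R] [IsStrictOrderedRing R] in
/-- **The closed half, quantitatively**:
`c1CrossClosedHalf · P¹(Q) = P⁰(Q) · c1Slack p[e↦1] + P¹(Q oU) · (P¹(Q bH) P⁰(Q) − P⁰(Q bH) P¹(Q))`
(a ring identity; at an `a₂`-edge the last factor is `≥ 0` by `bHQ_pin_open_mul_ge`). -/
theorem crossClosedHalf_mul_eq (p : E → R) (ends : E → Sym2 V) (a₁ a₂ o b : V) (e : E) :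
    c1CrossClosedHalf p ends a₁ a₂ o b e *
        prob (Function.update p e (1 : R)) (connEvent ends a₁ a₂)ᶜ =
      prob (Function.update p e (0 : R)) (connEvent ends a₁ a₂)ᶜ *
          c1Slack (Function.update p e (1 : R)) ends a₁ a₂ o b +
        prob (Function.update p e (1 : R))
            ((connEvent ends a₁ o ∪ connEvent ends a₂ o) ∩ (connEvent ends a₁ a₂)ᶜ) *
          (prob (Function.update p e (1 : R)) (connEvent ends a₂ b ∩ (connEvent ends a₁ a₂)ᶜ) *
              prob (Function.update p e (0 : R)) (connEvent ends a₁ a₂)ᶜ -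
            prob (Function.update p e (0 : R)) (connEvent ends a₂ b ∩ (connEvent ends a₁ a₂)ᶜ) *
              prob (Function.update p e (1 : R)) (connEvent ends a₁ a₂)ᶜ) := by
  unfold c1CrossClosedHalf c1Slack
  ring

/-- **The closed half of the cross term at an `a₂`-edge is nonnegative** as soon as the row holds
for `p[e↦1]`. -/
theorem crossClosedHalf_nonneg_of_row (p : E → R) (hp : IsProbVec p) (ends : E → Sym2 V) {e : E}
    {a₂ v : V} (hends : ends e = s(a₂, v)) (a₁ o b : V)
    (hrow : 0 ≤ c1Slack (Function.update p e (1 : R)) ends a₁ a₂ o b) :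
    0 ≤ c1CrossClosedHalf p ends a₁ a₂ o b e := by
  have hp0 : IsProbVec (Function.update p e (0 : R)) := hp.update e le_rfl zero_le_one
  have hp1 : IsProbVec (Function.update p e (1 : R)) := hp.update e zero_le_one le_rfl
  have hcmp := bHQ_pin_open_mul_ge p hp ends hends a₁ b
  have hid := crossClosedHalf_mul_eq p ends a₁ a₂ o b e
  set Q : Set (Config E) := (connEvent ends a₁ a₂)ᶜ with hQdef
  set bHQ : Set (Config E) := connEvent ends a₂ b ∩ (connEvent ends a₁ a₂)ᶜ with hbHQdef
  set oUQ : Set (Config E) :=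
    (connEvent ends a₁ o ∪ connEvent ends a₂ o) ∩ (connEvent ends a₁ a₂)ᶜ with hoUQdef
  set P0 := Function.update p e (0 : R) with hP0
  set P1 := Function.update p e (1 : R) with hP1
  have n0Q : 0 ≤ prob P0 Q := prob_nonneg hp0 _
  have n1Q : 0 ≤ prob P1 Q := prob_nonneg hp1 _
  have n1oU : 0 ≤ prob P1 oUQ := prob_nonneg hp1 _
  rcases n1Q.lt_or_eq with hpos | hzero
  · -- `P¹(Q) > 0`: both summands of the identity are `≥ 0`
    have key : 0 * prob P1 Q ≤ c1CrossClosedHalf p ends a₁ a₂ o b e * prob P1 Q := by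
      rw [hid]
      have t1 : 0 ≤ prob P0 Q * c1Slack P1 ends a₁ a₂ o b := mul_nonneg n0Q hrow
      have t2 : 0 ≤ prob P1 oUQ * (prob P1 bHQ * prob P0 Q - prob P0 bHQ * prob P1 Q) :=
        mul_nonneg n1oU (sub_nonneg.2 hcmp)
      linarith
    exact le_of_mul_le_mul_right key hpos
  · -- `P¹(Q) = 0`: the `P¹` masses inside `Q` vanish and the closed half is `0`
    have h1 : prob P1 ((connEvent ends a₁ o ∪ connEvent ends a₂ o) ∩
        (connEvent ends a₁ b ∪ connEvent ends a₂ b) ∩ (connEvent ends a₁ a₂)ᶜ) = 0 :=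
      le_antisymm (by rw [hzero]; exact prob_mono hp1 Set.inter_subset_right) (prob_nonneg hp1 _)
    have h2 : prob P1 oUQ = 0 :=
      le_antisymm (by rw [hzero]; exact prob_mono hp1 Set.inter_subset_right) n1oU
    unfold c1CrossClosedHalf
    rw [h1, h2]
    simp

end CrossRootB

end RowC1

end Summit.Ventures.PercRepro2
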